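import Literature.AlgebraicGeometry.Smoothening.ProjectiveModel
import Literature.AlgebraicGeometry.Smoothening.LocalPoints
import Literature.AlgebraicGeometry.Motives.VarietiesProjectiveSpaceProofs
import Mathlib.AlgebraicGeometry.Morphisms.ClosedImmersion
import HarnessLib

/-!
# Affine charts of a projective model and the points they capture (BLR 1.1, 3.5)

Topic: `Literature/AlgebraicGeometry/Smoothening` (Bosch–Lütkebohmert–Raynaud, *Néron Models*,
§1.1, §3.5; M. Artin, *Néron Models*, Lemma (3.6): "Choose an affine presentation of a
neighborhood of `x'` in `V`: `R[x]/(f)`"). A projective model `P ⊆ ℙⁿ_R` of a projective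
`K`-scheme `E` (`ProjectiveModel`) is covered by the preimages of the standard charts
`D₊(xₛ) ≅ Spec R[y₁, …, yₙ]` of `ℙⁿ_R` (`Motives.ProjectiveSpace.chartAlgEquiv`); each is a closed
subscheme of `Spec R[y]`, i.e. `Spec (R[y₁, …, yₙ]/Iₛ)` for an ideal `Iₛ` (Mathlib
`IsClosedImmersion.Spec_iff`): `ProjectiveModel.chartIdeal`, `ProjectiveModel.chart` (an open
immersion `Spec (R[y]/Iₛ) → P` over `Spec R`, `chart_hom`), `ProjectiveModel.chartCover`. Hence
(`ProjectiveModel.exists_algHom_of_point`): for a valuation ring `O` over `R` with fraction field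
`L ⊇ K`, **every `L`-valued point of `E` over `K` is the generic point of an `O`-valued point of
one of the charts**, an `R`-algebra homomorphism `R[y]/Iₛ → O` (valuative criterion for the proper
`P → Spec R`, then factorisation through an open chart, `LocalPoints`). These are the chart rings
and test points to which the smoothening process (`Forest`) is applied. [folklore]; no named facts
(D-0026).

## References

* S. Bosch, W. Lütkebohmert, M. Raynaud, *Néron Models*, Springer 1990, §1.1, §3.5.
  [BLRNeronModels1990] (Not held; numbers only.)
* M. Artin, *Néron Models*, in Cornell–Silverman (eds.), *Arithmetic Geometry*, Springer 1986,
  Lemma (3.6), (3.7) (p. 225). [Artin1986NeronModels]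
-/

noncomputable section

open CategoryTheory CategoryTheory.Limits AlgebraicGeometry MvPolynomial HomogeneousLocalization
open Literature.AlgebraicGeometry.Motives

attribute [local instance] MvPolynomial.gradedAlgebra
  Literature.AlgebraicGeometry.Motives.ProjBaseChange.algebraBase

namespace Literature.AlgebraicGeometry.Smoothening

universe u

/-! ### The standard charts of `ℙⁿ_R` over a ring -/

section Ambient

variable (R : Type u) [CommRing R] (n : ℕ)

local notation "𝒜" => MvPolynomial.homogeneousSubmodule (Fin (n + 1)) R

/-- The variables generate the irrelevant ideal of `R[x₀, …, xₙ]` (ring version of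
`Motives.ProjectiveSpace.irrelevant_le_span`). [folklore] -/
theorem irrelevant_le_span_X :
    (HomogeneousIdeal.irrelevant 𝒜).toIdeal ≤
      Ideal.span (Set.range (X : Fin (n + 1) → MvPolynomial (Fin (n + 1)) R)) := by
  rw [HomogeneousIdeal.toIdeal_irrelevant_le]
  intro i hi p (hp : p ∈ 𝒜 i)
  change p ∈ Ideal.span _
  rw [← Set.image_univ, MvPolynomial.mem_ideal_span_X_image]
  intro m hm
  have hdeg : m.degree = i := by
    rw [Finsupp.degree_eq_weight_one]
    exact hp (mem_support_iff.mp hm)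
  by_contra! h
  refine hi.ne' (hdeg.symm.trans ((Finsupp.degree_eq_zero_iff m).mpr ?_))
  ext s
  simpa using h s

/-- **The `s`-th standard chart** `Spec (R[x]_{xₛ})₀ = D₊(xₛ) → ℙⁿ_R` (Mathlib `Proj.awayι`).
[folklore] -/
abbrev awayιX (s : Fin (n + 1)) : Spec (.of (Away 𝒜 (X s))) ⟶ Proj 𝒜 :=
  Proj.awayι 𝒜 (X s) (ProjectiveSpace.X_mem s) zero_lt_one

/-- **The standard charts cover `ℙⁿ_R`.** [folklore] -/
theorem exists_mem_range_awayιX (x : Proj 𝒜) : ∃ s : Fin (n + 1), x ∈ Set.range (awayιX R n s).base := by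
  have hx : x ∈ (⊤ : (Proj 𝒜).Opens) := trivial
  rw [← Proj.iSup_basicOpen_eq_top 𝒜 (fun s : Fin (n + 1) => (X s : MvPolynomial (Fin (n + 1)) R))
    (irrelevant_le_span_X R n), TopologicalSpace.Opens.mem_iSup] at hx
  obtain ⟨s, hs⟩ := hx
  refine ⟨s, ?_⟩
  rw [← Scheme.Hom.coe_opensRange, Proj.opensRange_awayι]
  exact hs

/-- On the chart the structure morphism `ℙⁿ_R → Spec R` is `Spec` of `R → (R[x]_{xₛ})₀`.
[folklore] -/
theorem awayιX_projToSpec (s : Fin (n + 1)) :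
    awayιX R n s ≫ ProjBaseChangeRing.projToSpec (Fin (n + 1)) R =
      Spec.map (CommRingCat.ofHom (algebraMap R (Away 𝒜 (X s)))) :=
  ProjBaseChangeRing.awayι_projToSpec (Fin (n + 1)) (ProjectiveSpace.X_mem s) zero_lt_one

/-- `Spec (R[x]_{xₛ})₀ ≅ Spec R[y₁, …, yₙ]` (`Spec` of `Motives.ProjectiveSpace.chartAlgEquiv`).
[folklore] -/
def specChartIso (s : Fin (n + 1)) :
    Spec (.of (Away 𝒜 (X s))) ≅ Spec (.of (MvPolynomial (Fin n) R)) where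
  hom := Spec.map (CommRingCat.ofHom (ProjectiveSpace.chartAlgEquiv R s).symm.toRingEquiv.toRingHom)
  inv := Spec.map (CommRingCat.ofHom (ProjectiveSpace.chartAlgEquiv R s).toRingEquiv.toRingHom)
  hom_inv_id := by
    have h : (ProjectiveSpace.chartAlgEquiv R s).symm.toRingEquiv.toRingHom.comp
        (ProjectiveSpace.chartAlgEquiv R s).toRingEquiv.toRingHom = RingHom.id _ :=
      RingHom.ext fun x => (ProjectiveSpace.chartAlgEquiv R s).symm_apply_apply x
    rw [← Spec.map_comp, ← CommRingCat.ofHom_comp, h, CommRingCat.ofHom_id, Spec.map_id]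
  inv_hom_id := by
    have h : (ProjectiveSpace.chartAlgEquiv R s).toRingEquiv.toRingHom.comp
        (ProjectiveSpace.chartAlgEquiv R s).symm.toRingEquiv.toRingHom = RingHom.id _ :=
      RingHom.ext fun x => (ProjectiveSpace.chartAlgEquiv R s).apply_symm_apply x
    rw [← Spec.map_comp, ← CommRingCat.ofHom_comp, h, CommRingCat.ofHom_id, Spec.map_id]

end Ambient

/-! ### The charts of a projective model -/

namespace ProjectiveModel

variable {R K : Type u} [CommRing R] [Field K] [Algebra R K] {E : SchemeOver K}
  (M : ProjectiveModel R K E)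

/-- The preimage `Pₛ = P ∩ D₊(xₛ)` of the `s`-th standard chart. [folklore] -/
abbrev piece (s : Fin (M.n + 1)) : Scheme.{u} := pullback M.emb (awayιX R M.n s)

/-- `Pₛ → Spec R[y₁, …, yₙ]`, a closed immersion (base change of `P ↪ ℙⁿ_R`, then the chart
isomorphism). [folklore] -/
def toAffine (s : Fin (M.n + 1)) : M.piece s ⟶ Spec (.of (MvPolynomial (Fin M.n) R)) :=
  pullback.snd M.emb (awayιX R M.n s) ≫ (specChartIso R M.n s).hom

/-- `Pₛ → Spec R[y]` is a closed immersion. [folklore] -/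
instance isClosedImmersion_toAffine (s : Fin (M.n + 1)) : IsClosedImmersion (M.toAffine s) := by
  unfold toAffine; infer_instance

/-- **The ideal of the `s`-th chart**: `Pₛ = Spec (R[y]/Iₛ)` (Mathlib `IsClosedImmersion.Spec_iff`).
[folklore] -/
def chartIdeal (s : Fin (M.n + 1)) : Ideal (MvPolynomial (Fin M.n) R) :=
  (IsClosedImmersion.Spec_iff.mp (M.isClosedImmersion_toAffine s)).choose

/-- `Pₛ ≅ Spec (R[y]/Iₛ)`. [folklore] -/
def pieceIso (s : Fin (M.n + 1)) :
    M.piece s ≅ Spec (.of (MvPolynomial (Fin M.n) R ⧸ M.chartIdeal s)) :=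
  (IsClosedImmersion.Spec_iff.mp (M.isClosedImmersion_toAffine s)).choose_spec.choose

/-- `Pₛ → Spec R[y]` is `Pₛ ≅ Spec (R[y]/Iₛ) → Spec R[y]`. [folklore] -/
theorem toAffine_eq (s : Fin (M.n + 1)) :
    M.toAffine s = (M.pieceIso s).hom ≫
      Spec.map (CommRingCat.ofHom (Ideal.Quotient.mk (M.chartIdeal s))) :=
  (IsClosedImmersion.Spec_iff.mp (M.isClosedImmersion_toAffine s)).choose_spec.choose_spec

/-- **The `s`-th chart** `Spec (R[y₁, …, yₙ]/Iₛ) → P`, an open immersion onto `P ∩ D₊(xₛ)`.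
[folklore] -/
def chart (s : Fin (M.n + 1)) : Spec (.of (MvPolynomial (Fin M.n) R ⧸ M.chartIdeal s)) ⟶ M.P :=
  (M.pieceIso s).inv ≫ pullback.fst M.emb (awayιX R M.n s)

/-- The chart is an open immersion. [folklore] -/
instance isOpenImmersion_chart (s : Fin (M.n + 1)) : IsOpenImmersion (M.chart s) := by
  unfold chart; infer_instance

/-- `pullback.snd` in terms of the chart data. [folklore] -/
theorem pullback_snd_eq (s : Fin (M.n + 1)) :
    pullback.snd M.emb (awayιX R M.n s) = (M.pieceIso s).hom ≫
      Spec.map (CommRingCat.ofHom (Ideal.Quotient.mk (M.chartIdeal s))) ≫ (specChartIso R M.n s).inv := by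
  have h : M.toAffine s ≫ (specChartIso R M.n s).inv = pullback.snd M.emb (awayιX R M.n s) := by
    rw [toAffine, Category.assoc, Iso.hom_inv_id, Category.comp_id]
  rw [← h, toAffine_eq, Category.assoc]

/-- **The charts are `R`-schemes in the obvious way**: `Spec (R[y]/Iₛ) → P → Spec R` is `Spec` of
the structure map `R → R[y]/Iₛ`. [folklore] -/
theorem chart_hom (s : Fin (M.n + 1)) :
    M.chart s ≫ M.hom = Spec.map (CommRingCat.ofHom
      (algebraMap R (MvPolynomial (Fin M.n) R ⧸ M.chartIdeal s))) := by
  rw [chart, hom, Category.assoc, pullback.condition_assoc, awayιX_projToSpec, pullback_snd_eq]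
  simp only [Category.assoc, Iso.inv_hom_id_assoc]
  rw [specChartIso, ← Spec.map_comp, ← Spec.map_comp, ← CommRingCat.ofHom_comp,
    ← CommRingCat.ofHom_comp]
  congr 2
  refine RingHom.ext fun r => ?_
  change Ideal.Quotient.mk _ ((ProjectiveSpace.chartAlgEquiv R s) (algebraMap R _ r)) =
    Ideal.Quotient.mk _ (algebraMap R (MvPolynomial (Fin M.n) R) r)
  rw [AlgEquiv.commutes]

/-- **The charts cover the model.** [folklore] -/
theorem exists_mem_range_chart (x : M.P) : ∃ s, x ∈ Set.range (M.chart s).base := by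
  obtain ⟨s, hs⟩ := exists_mem_range_awayιX R M.n (M.emb.base x)
  refine ⟨s, ?_⟩
  have h1 : Set.range (M.chart s).base = Set.range (pullback.fst M.emb (awayιX R M.n s)).base := by
    rw [chart, Scheme.Hom.comp_base, TopCat.coe_comp, Set.range_comp,
      Set.range_eq_univ.mpr (M.pieceIso s).inv.surjective, Set.image_univ]
  rw [h1]
  change x ∈ Set.range (pullback.fst M.emb (awayιX R M.n s))
  rw [IsOpenImmersion.range_pullbackFst]
  exact hs

/-- **The open cover of the model by its charts.** [folklore] -/
def chartCover : M.P.OpenCover :=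
  Scheme.Cover.mkOfCovers (Fin (M.n + 1)) (fun s => Spec (.of (MvPolynomial (Fin M.n) R ⧸ M.chartIdeal s)))
    M.chart fun x => by
      obtain ⟨s, y, hy⟩ := M.exists_mem_range_chart x
      exact ⟨s, y, hy⟩

/-- **A local-ring point of the model factors through a chart.** [folklore] -/
theorem exists_chart_lift {O : Type u} [CommRing O] [IsLocalRing O] (g : Spec (.of O) ⟶ M.P) :
    ∃ (s : Fin (M.n + 1)) (l : Spec (.of O) ⟶ Spec (.of (MvPolynomial (Fin M.n) R ⧸ M.chartIdeal s))),
      l ≫ M.chart s = g :=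
  exists_lift_openCover M.chartCover g

/-- **Every `L`-valued point of `E` is the generic point of an `O`-valued point of a chart**, for a
valuation ring `O` over `R` with fraction field `L ⊇ K` (`K = Frac R`): valuative criterion for
the proper `P → Spec R`, then factorisation through an open chart; the `O`-point is an
`R`-algebra homomorphism `R[y]/Iₛ → O`. [folklore] -/
theorem exists_algHom_of_point {O L : Type u} [CommRing O] [IsDomain O] [ValuationRing O] [Field L]
    [Algebra O L] [IsFractionRing O L] [Algebra R O] [Algebra K L] [Algebra R L]
    [IsScalarTower R O L] [IsScalarTower R K L]
    (x : Spec (.of L) ⟶ E.left) (hx : x ≫ E.hom = Spec.map (CommRingCat.ofHom (algebraMap K L))) :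
    ∃ (s : Fin (M.n + 1)) (a : (MvPolynomial (Fin M.n) R ⧸ M.chartIdeal s) →ₐ[R] O),
      Spec.map (CommRingCat.ofHom (algebraMap O L)) ≫ Spec.map (CommRingCat.ofHom a.toRingHom) ≫
        M.chart s = x ≫ M.gen := by
  -- the valuative lift `Spec O → P`
  have w : (x ≫ M.gen) ≫ M.hom = Spec.map (CommRingCat.ofHom (algebraMap O L)) ≫
      Spec.map (CommRingCat.ofHom (algebraMap R O)) := by
    rw [Category.assoc, M.gen_hom, reassoc_of% hx, ← Spec.map_comp, ← Spec.map_comp,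
      ← CommRingCat.ofHom_comp, ← CommRingCat.ofHom_comp, ← IsScalarTower.algebraMap_eq,
      ← IsScalarTower.algebraMap_eq]
  obtain ⟨l, hl₁, hl₂⟩ := exists_lift_of_isProper M.hom O L (x ≫ M.gen)
    (Spec.map (CommRingCat.ofHom (algebraMap R O))) w
  -- factor it through a chart
  obtain ⟨s, l', hl'⟩ := M.exists_chart_lift l
  refine ⟨s, ?_⟩
  -- the ring homomorphism `R[y]/Iₛ → O` is an `R`-algebra homomorphism
  let φ := Spec.preimage l'
  have hφ : Spec.map φ = l' := Spec.map_preimage l'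
  have hcomm : CommRingCat.ofHom (algebraMap R (MvPolynomial (Fin M.n) R ⧸ M.chartIdeal s)) ≫ φ =
      CommRingCat.ofHom (algebraMap R O) := by
    apply Spec.map_injective
    rw [Spec.map_comp, hφ, ← M.chart_hom s, reassoc_of% hl', hl₂]
  have hcomm' : ∀ r, φ.hom (algebraMap R _ r) = algebraMap R O r := fun r => by
    have := congrArg (fun f : CommRingCat.of R ⟶ CommRingCat.of O => f.hom r) hcomm
    simpa using this
  let a : (MvPolynomial (Fin M.n) R ⧸ M.chartIdeal s) →ₐ[R] O :=
    { φ.hom with commutes' := hcomm' }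
  refine ⟨a, ?_⟩
  have ha : CommRingCat.ofHom a.toRingHom = φ := rfl
  rw [ha, hφ, hl', hl₁]

end ProjectiveModel

end Literature.AlgebraicGeometry.Smoothening

end
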